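import Summits.Ventures.PercRepro.C025ProfilePLDClosureCorollaries
import Summits.Ventures.PercRepro.C025ProfilePLDSymCounterexample

/-!
# THE CERTIFICATE LEMMA: POINTWISE SYMMETRISED CERTIFICATES LIFT TO (PLD)-CONSEQUENCES (night-3 g30)

`proofs/NIGHT3-G30-PAREXT.md` §9.  A target inequality `Σ_{I ⊆ E} gL(ρI, ρ(E∖I)) ≤ Σ_{I ⊆ E} gR(ρI, ρ(E∖I))` on a finite matroid
`M` of rank `≤ R` follows from PER-LAYER DOMINANCE of `M` as soon as there is a list of (PLD) instances
`(lo, hi, δ, Θ)` with multipliers `N` such that, POINTWISE on the rank range `[0, R]²` and after symmetrisation by the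
complement `(x, f) ↦ (f, x)`,
  `gL(x,f) + gL(f,x) + Σ_k N_k·(wR_k(x,f) + wR_k(f,x))  ≤  gR(x,f) + gR(f,x) + Σ_k N_k·(wL_k(x,f) + wL_k(f,x))`,
where `wL_k, wR_k` are the left and right summands of the `k`-th instance.  This is exactly the shape of a
linear-programming (Farkas) certificate in symmetric coordinates, and for a concrete list it is a finite computation
(`decide`).  Proof by induction on the list: each instance is absorbed into `gL, gR` and paid by (PLD)(M) through
`PLDClosure.sum_complement`.  No `def`, no `instance`, no notation.  Axioms: standard.
-/

open scoped Matroid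

namespace PercRepro

open Finset ThmH

namespace PLDCert

variable {α : Type} [DecidableEq α]

omit [DecidableEq α] in
/-- ranks are bounded by the rank of the matroid, in `ℕ` -/
theorem toNat_eRk_le_of_eRank_le (M : Matroid α) {R : ℕ} (h : M.eRank ≤ R) (X : Set α) : (M.eRk X).toNat ≤ R :=
  ENat.toNat_le_of_le_coe ((M.eRk_le_eRank X).trans h)

/-- THE CERTIFICATE LEMMA.  `L` lists instances `(lo, hi, δ, Θ, N)`; `hadm` their admissibility; `hcert` the pointwise
symmetrised certificate on `[0, R]²`. -/
theorem sum_le_of_cert (M : Matroid α) [M.Finite]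
    (hPLD : ∀ lo hi δ Θ : ℕ, Θ ≤ lo + hi + δ → (lo = 0 ∨ lo + hi + δ ≤ Θ) →
      (∑ I ∈ (gr M).powerset, (if lo ≤ (M.eRk (I : Set α)).toNat ∧ (M.eRk (I : Set α)).toNat ≤ hi ∧
          Θ ≤ (M.eRk ((gr M \ I : Finset α) : Set α)).toNat + (M.eRk (I : Set α)).toNat then
          ((M.eRk ((gr M \ I : Finset α) : Set α)).toNat).choose δ else 0)) ≤
        ∑ I ∈ (gr M).powerset, (if lo + δ ≤ (M.eRk ((gr M \ I : Finset α) : Set α)).toNat ∧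
          (M.eRk ((gr M \ I : Finset α) : Set α)).toNat ≤ hi + δ then
          ((M.eRk ((gr M \ I : Finset α) : Set α)).toNat).choose δ else 0))
    (R : ℕ) (hR : M.eRank ≤ R) (L : List (ℕ × ℕ × ℕ × ℕ × ℕ))
    (hadm : ∀ k ∈ L, k.2.2.2.1 ≤ k.1 + k.2.1 + k.2.2.1 ∧ (k.1 = 0 ∨ k.1 + k.2.1 + k.2.2.1 ≤ k.2.2.2.1))
    (gL gR : ℕ → ℕ → ℕ)
    (hcert : ∀ x ∈ range (R + 1), ∀ f ∈ range (R + 1),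
      gL x f + gL f x + (L.map (fun k : ℕ × ℕ × ℕ × ℕ × ℕ => k.2.2.2.2 *
        ((if k.1 + k.2.2.1 ≤ f ∧ f ≤ k.2.1 + k.2.2.1 then f.choose k.2.2.1 else 0) +
          (if k.1 + k.2.2.1 ≤ x ∧ x ≤ k.2.1 + k.2.2.1 then x.choose k.2.2.1 else 0)))).sum ≤
      gR x f + gR f x + (L.map (fun k : ℕ × ℕ × ℕ × ℕ × ℕ => k.2.2.2.2 *
        ((if k.1 ≤ x ∧ x ≤ k.2.1 ∧ k.2.2.2.1 ≤ f + x then f.choose k.2.2.1 else 0) +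
          (if k.1 ≤ f ∧ f ≤ k.2.1 ∧ k.2.2.2.1 ≤ x + f then x.choose k.2.2.1 else 0)))).sum) :
    ∑ I ∈ (gr M).powerset, gL (M.eRk (I : Set α)).toNat (M.eRk ((gr M \ I : Finset α) : Set α)).toNat ≤
      ∑ I ∈ (gr M).powerset, gR (M.eRk (I : Set α)).toNat (M.eRk ((gr M \ I : Finset α) : Set α)).toNat := by
  induction L generalizing gL gR with
  | nil =>
    simp only [List.map_nil, List.sum_nil, add_zero] at hcert
    have hsum := Finset.sum_le_sum (s := (gr M).powerset) fun I _ =>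
      hcert (M.eRk (I : Set α)).toNat (mem_range.2 (Nat.lt_succ_of_le (toNat_eRk_le_of_eRank_le M hR _)))
        (M.eRk ((gr M \ I : Finset α) : Set α)).toNat
        (mem_range.2 (Nat.lt_succ_of_le (toNat_eRk_le_of_eRank_le M hR _)))
    rw [Finset.sum_add_distrib, Finset.sum_add_distrib, ← PLDClosure.sum_complement M gL,
      ← PLDClosure.sum_complement M gR] at hsum
    omega
  | cons k L ih =>
    simp only [List.map_cons, List.sum_cons] at hcert
    have hadk := hadm k (List.mem_cons_self ..)
    have hadL : ∀ k' ∈ L, k'.2.2.2.1 ≤ k'.1 + k'.2.1 + k'.2.2.1 ∧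
        (k'.1 = 0 ∨ k'.1 + k'.2.1 + k'.2.2.1 ≤ k'.2.2.2.1) :=
      fun k' hk' => hadm k' (List.mem_cons_of_mem _ hk')
    have key := ih hadL
      (fun x f => gL x f + k.2.2.2.2 * (if k.1 + k.2.2.1 ≤ f ∧ f ≤ k.2.1 + k.2.2.1 then f.choose k.2.2.1 else 0))
      (fun x f => gR x f + k.2.2.2.2 * (if k.1 ≤ x ∧ x ≤ k.2.1 ∧ k.2.2.2.1 ≤ f + x then f.choose k.2.2.1 else 0))
      (fun x hx f hf => by
        have h := hcert x hx f hf
        linarith)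
    beta_reduce at key
    rw [Finset.sum_add_distrib, Finset.sum_add_distrib, ← Finset.mul_sum, ← Finset.mul_sum] at key
    have hk := hPLD k.1 k.2.1 k.2.2.1 k.2.2.2.1 hadk.1 hadk.2
    have hk' := Nat.mul_le_mul_left k.2.2.2.2 hk
    linarith

end PLDCert

end PercRepro
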